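import Summits.BirchSwinnertonDyer.BirchSwinnertonDyer.Theorems.ManinLocalTwoThreeNegOneTwistConductorAtTwoWild
import Summits.BirchSwinnertonDyer.BirchSwinnertonDyer.Theorems.ManinLocalTwoThreeNegOneTwistConductorFourMulHolds
import HarnessLib

/-!
# S-an-60 in CONDUCTOR-NORM form: `8 ∥ N(W) ⟹ N(W ⊗ χ₋₄) = 2·N(W)` — the body of an's node `NegOneTwistConductorTwoMul`
# (route `ManinLocalTwoThree`, crux C2 `ManinOddAtFour` stmt-BirchSwinnertonDyer-22967; cell bsd-f2-manin, an g32 MEMO-an §75.9 / All.lean §9,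
# typer B5b; p2 gen 13)

At `2` the exponent goes `3 ↦ 4` (this seat's `conductorExponent_quadraticTwist_negOne_eq_four_of_eq_three`, Tate's algorithm over `ℤ₂`,
Barrios et al. 2025 Thm. 5.1 rows III / I₁* / III* / II*), off `2` the twist by `−1` is unramified (`conductorExponent_quadraticTwist_negOne_eq_of_ne_two`),
and the conductor is `∏ p^{f_p}`.  The statement below is an's def body VERBATIM, so that once the node `NegOneTwistConductorTwoMul` is in the tree
(typer B5b) `negOneTwistConductorTwoMul_holds := fun W _ h8 h16 ↦ conductorNorm_quadraticTwist_negOne_eq_two_mul W h8 h16`; with S-an-58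
(`negOneTwistConductorFourMul_holds`) an's §9bis chain `maninOddAtFour_of_maninOddAtSixteen` then reads: C2 ⟺ `ManinOddAtSixteen` modulo
`exists_isNewformOf`, with NO print input (the LEAD's trigger, STATUS 04:58:06Z).

HONEST FRAMING: local/global conductor bookkeeping in print, kernel-checked.  BSD is not proved; Manin's conjecture is not proved; C2 OPEN
(its `16 ∣ N` stratum is untouched). [cite: BarriosEtAl2025, Thm. 5.1, rows III / I₁* / III* / II*] [cite: SilvermanAEC2009, C.16]
-/

set_option autoImplicit false
-- lint-debt: the directory name repeats the summit name (sibling precedent `ManinLocalTwoThreeNegOneTwistConductorAtTwo.lean`)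
set_option linter.dupNamespace false

noncomputable section

open scoped Classical
open WeierstrassCurve IsDedekindDomain IsDedekindDomain.HeightOneSpectrum Rat.HeightOneSpectrum
  Literature.NumberTheory.DiophantineGeometry Literature.NumberTheory.EllipticCurves

namespace Summit.BirchSwinnertonDyer.BirchSwinnertonDyer.Theorems.ManinLocalTwoThree

/-- `8 ∥ N_E` means `f₂ = 3` at the place `v` of `ℤ` above `2` (`N_E = ∏ p ^ f_p`). [cite: SilvermanAEC2009, C.16] -/
theorem conductorExponent_eq_three_of_eight_dvd_conductorNorm (W : WeierstrassCurve ℚ) [W.IsElliptic] (v : HeightOneSpectrum ℤ)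
    (hv : natGenerator v = 2) (h8 : 2 ^ 3 ∣ W.conductorNorm ℤ) (h16 : ¬ 2 ^ 4 ∣ W.conductorNorm ℤ) :
    W.conductorExponent v = 3 := by
  have hN : W.conductorNorm ℤ ≠ 0 := (W.conductorNorm_pos_holds).ne'
  have hfac : (W.conductorNorm ℤ).factorization 2 = W.conductorExponent v := by
    rw [← hv]; exact W.factorization_conductorNorm_holds v
  rw [Nat.prime_two.pow_dvd_iff_le_factorization hN, hfac] at h8 h16
  omega

/-- **`v₂(N) = 3 ⟹ v₂(N′) = 4`** for `N′ = N(W ⊗ (−1))`. [cite: BarriosEtAl2025, Thm. 5.1, rows III / I₁* / III* / II*] -/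
theorem padicValNat_two_conductorNorm_quadraticTwist_negOne_of_eq_three (W : WeierstrassCurve ℚ) [W.IsElliptic]
    (hN : padicValNat 2 (W.conductorNorm ℤ) = 3) :
    padicValNat 2 ((W.quadraticTwist ((-1 : ℤ) : ℚ)).conductorNorm ℤ) = 4 := by
  haveI : Fact (Nat.Prime 2) := ⟨Nat.prime_two⟩
  have hd0 : ((-1 : ℤ) : ℚ) ≠ 0 := by norm_num
  haveI := W.isElliptic_quadraticTwist hd0
  set v : HeightOneSpectrum ℤ := (primesEquiv (R := ℤ)).symm ⟨2, Nat.prime_two⟩ with hvdef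
  have hv : natGenerator v = 2 := congrArg Subtype.val ((primesEquiv (R := ℤ)).apply_symm_apply ⟨2, Nat.prime_two⟩)
  have hfacW : (W.conductorNorm ℤ).factorization 2 = W.conductorExponent v := by
    rw [← hv]; exact W.factorization_conductorNorm_holds v
  have hfacT : ((W.quadraticTwist ((-1 : ℤ) : ℚ)).conductorNorm ℤ).factorization 2 =
      (W.quadraticTwist ((-1 : ℤ) : ℚ)).conductorExponent v := by
    rw [← hv]; exact (W.quadraticTwist ((-1 : ℤ) : ℚ)).factorization_conductorNorm_holds v
  rw [← Nat.factorization_def _ Nat.prime_two] at hN ⊢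
  rw [hfacT]
  exact conductorExponent_quadraticTwist_negOne_eq_four_of_eq_three W (by rw [← hfacW]; exact hN)

/-- `ord₂ 2 = 1` on the factorization side. [folklore] -/
theorem factorization_two_two : (2 : ℕ).factorization 2 = 1 := Nat.prime_two.factorization_self

/-- `ord_p 2 = 0` for `p ≠ 2`. [folklore] -/
theorem factorization_two_of_ne_two {p : ℕ} (hp : p ≠ 2) : (2 : ℕ).factorization p = 0 := by
  rw [Nat.prime_two.factorization, Finsupp.single_apply, if_neg (Ne.symm hp)]

/-- **S-an-60 `NegOneTwistConductorTwoMul` (an g32, MEMO-an §75.9), PROVED: `8 ∥ N(W) ⟹ N(W ⊗ (−1)) = 2·N(W)`** — an's def body verbatim.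
At `2`: `f₂ = 3 ↦ 4`; off `2`: `f_p` unchanged; unique factorization. [cite: BarriosEtAl2025, Thm. 5.1, rows III / I₁* / III* / II*]
[cite: SilvermanAEC2009, C.16] -/
theorem conductorNorm_quadraticTwist_negOne_eq_two_mul (W : WeierstrassCurve ℚ) [W.IsElliptic]
    (h8 : 2 ^ 3 ∣ W.conductorNorm ℤ) (h16 : ¬ 2 ^ 4 ∣ W.conductorNorm ℤ) :
    (haveI := W.isElliptic_quadraticTwist (show ((-1 : ℤ) : ℚ) ≠ 0 by norm_num);
      (W.quadraticTwist ((-1 : ℤ) : ℚ)).conductorNorm ℤ) = 2 * W.conductorNorm ℤ := by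
  haveI : Fact (Nat.Prime 2) := ⟨Nat.prime_two⟩
  have hd0 : ((-1 : ℤ) : ℚ) ≠ 0 := by norm_num
  haveI := W.isElliptic_quadraticTwist hd0
  have hN0 : W.conductorNorm ℤ ≠ 0 := (conductorNorm_pos_holds W).ne'
  have hN0' : (W.quadraticTwist ((-1 : ℤ) : ℚ)).conductorNorm ℤ ≠ 0 := (conductorNorm_pos_holds _).ne'
  have h2 : (W.conductorNorm ℤ).factorization 2 = 3 := by
    rw [Nat.prime_two.pow_dvd_iff_le_factorization hN0] at h8 h16
    omega
  have h2' : ((W.quadraticTwist ((-1 : ℤ) : ℚ)).conductorNorm ℤ).factorization 2 = 4 := by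
    rw [Nat.factorization_def _ Nat.prime_two]
    exact padicValNat_two_conductorNorm_quadraticTwist_negOne_of_eq_three W
      (by rw [← Nat.factorization_def _ Nat.prime_two]; exact h2)
  show (W.quadraticTwist ((-1 : ℤ) : ℚ)).conductorNorm ℤ = 2 * W.conductorNorm ℤ
  refine Nat.eq_of_factorization_eq hN0' (mul_ne_zero (by norm_num) hN0) fun p ↦ ?_
  rw [Nat.factorization_mul (by norm_num : (2 : ℕ) ≠ 0) hN0, Finsupp.add_apply]
  by_cases hp : p.Prime
  swap
  · rw [Nat.factorization_eq_zero_of_not_prime _ hp, Nat.factorization_eq_zero_of_not_prime _ hp,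
      Nat.factorization_eq_zero_of_not_prime _ hp]
  by_cases hp2 : p = 2
  · subst hp2
    rw [h2', h2, factorization_two_two]
  · rw [factorization_two_of_ne_two hp2, zero_add]
    have e1 := factorization_conductorNorm_primesEquiv_symm W ⟨p, hp⟩
    have e2 := factorization_conductorNorm_primesEquiv_symm (W.quadraticTwist ((-1 : ℤ) : ℚ)) ⟨p, hp⟩
    simp only at e1 e2
    rw [e1, e2]
    exact conductorExponent_quadraticTwist_negOne_eq_of_ne_two W _
      (by rw [Literature.NumberTheory.EllipticCurves.Rat.natGenerator_primesEquiv_symm ⟨p, hp⟩]; exact hp2)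

/-- **Corollary (the stratum form): `8 ∥ N(W) ⟹ 16 ∥ N(W ⊗ (−1))`.** [cite: BarriosEtAl2025, Thm. 5.1, rows III / I₁* / III* / II*] -/
theorem sixteen_dvd_conductorNorm_quadraticTwist_negOne_of_eight (W : WeierstrassCurve ℚ) [W.IsElliptic]
    (h8 : 2 ^ 3 ∣ W.conductorNorm ℤ) (h16 : ¬ 2 ^ 4 ∣ W.conductorNorm ℤ) :
    (haveI := W.isElliptic_quadraticTwist (show ((-1 : ℤ) : ℚ) ≠ 0 by norm_num);
      2 ^ 4 ∣ (W.quadraticTwist ((-1 : ℤ) : ℚ)).conductorNorm ℤ ∧ ¬ 2 ^ 5 ∣ (W.quadraticTwist ((-1 : ℤ) : ℚ)).conductorNorm ℤ) := by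
  have h := conductorNorm_quadraticTwist_negOne_eq_two_mul W h8 h16
  refine ⟨?_, ?_⟩
  · rw [h, show (2 : ℕ) ^ 4 = 2 * 2 ^ 3 by norm_num]
    exact Nat.mul_dvd_mul_left 2 h8
  · rw [h, show (2 : ℕ) ^ 5 = 2 * 2 ^ 4 by norm_num]
    intro h5
    exact h16 (Nat.dvd_of_mul_dvd_mul_left (by norm_num) h5)

end Summit.BirchSwinnertonDyer.BirchSwinnertonDyer.Theorems.ManinLocalTwoThree

end
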